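import Summits.QuantumFields.YangMills.Theorems.BalabanUVNodesN27AtReadingOfRecord12
import Summits.QuantumFields.YangMills.Theorems.BalabanUVNodesN18AtReadingOnTables
import Summits.QuantumFields.YangMills.Theorems.BalabanUVNodesN15AtRateRecord12V1
import Summits.QuantumFields.YangMills.Theorems.BalabanUVNodesN22EdgeAtW1AdmReadingOfRecord12

/-!
# BalabanUVNodes ∕ N27 = binder B5 AT THE RECORD, XXXI — N27 AT THE ADMISSIBLE RATE READING OF RECORD
# `readingOfRecord₁₂ (fun F θ ↦ Node00.W1.ReadingData.ofRecordAdm F θ.τ9.M N (S F θ) (sp F θ) (gauge F θ) (hg F θ) (T₀ F θ) (hT F θ) (li F θ)) ℓ₃ ne2 ne1`: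
# XXIX's two junctions of record (canonical home → `Spine ₁₂C`, regime home → `Spine` at `IsRecordOfRecord₁₂COn F N Rg`) INSTANTIATED at the W1 reading the
# children re-keyed to — background slots = the ADMISSIBLE backgrounds `AdmBg` (the gauge fields READ INSIDE the space tables `sp F θ`, node00-def-W1 g4
# `Node00/RateRecordW1MapsAdm`, dag-n22-c's (R1)) — with every rate slot that HAS a landed producer there CONSUMED BY NAME: N17 eliminated (dag-n17-a), N22 eliminated
# given N18 (dag-n22-e module 8a, hypotheses verbatim), N18 from THE END's (2.38)-envelope data (dag-n18-d module 12, verbatim), N16 from `InEndRegime ∧ LeafSlot`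
# (dag-n16-e), N15 from dag-n15-c's `V′₁(A′)` family (dag-n15-a part 32, verbatim); N14, (D4) and the spine side displayed
# (cell `pub-ymgap`, HUMAN RULING D-0062 Track A, R134 seat `pub-ymgap-dag-n27-c` (s2) gen 5; `--supports` the K3′ item `SpineGivenEndpointR12` stmt-QuantumFields-19908
# `--as helper`; COUNT-NEUTRAL; `N`-generic, regime-generic, NO Theses import, restate-immune; 0 `def`, 0 `sorry`)

WHY.  XXIX (p479443) typed K3′'s rate side at dag-n22-e's reading of record EDITION 1 with the W1 component `w1` a PARAMETER.  Tonight the children fixed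
that component: node00-def-W1's all-fields pairing `LevelPairing.ofRecord` over-reaches the print ([I] (1.18) p. 263 holds «for (𝐔, 𝐉) ∈ U^c_j(X, α₀, α₁)»
only — dag-n18-c ∕ dag-n22-c LOCATED-BGA), so the definer filed `ReadingData.ofRecordAdm` (run backgrounds := `AdmBg F M N sp k`, readings in the tables BY
TYPE, transport restricted along a DISPLAYED preservation clause `hT`), and the producers re-instantiated there: dag-n18-d module 12 `…N18AtReadingOnTables`
(p482346: `s_N18_readingAdm₁₂_iff`, `s_N18_readingAdm₁₂_of_envelope_bound238` — the END junction with the embedding ∕ pairing clauses GONE), dag-n22-c module 13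
`…N22W1StripAdmReading` (p482103: `pairingCoherence_ofRecordAdm`), dag-n15-a part 32 `…N15AtRateRecord12V1` (p484013: the `h15` slot at ANY `w1` from a `V′₁`-valued
residual layer), dag-n22-e module 8a `…N22EdgeAtW1AdmReadingOfRecord12` (the edge N18 → N22 at this reading — analytic sup-letter currency at both homes, STRIP on the
reading's OWN table at the regime home — with the readings clause discharged BY TYPE).  This module is the JUNCTION OF RECORD at that reading —
what B5 at the Stage-12 record costs there, slot by slot, with the producers' hypotheses carried VERBATIM where they exist (the kernel certifies that
their conclusions ARE the slots).

FIELD-BY-FIELD TABLE (rate side at the admissible reading of record; `θ` = the datum key's `h.params` at the canonical home, the tuple itself at the regime home):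
* N14 · NE1′ — `N14At (ne1 F θ g₀ os)` on NODE O's RESIDUAL dressed tower (displayed; dag-n14-c's convex-fibre engine C–F is the s1 road, not yet a face here).
* N15 · NE2 — `N15At (ne2OfRecord₁₁ (ne2 F θ g₀ os k))` (displayed) OR, §1 (3), `ne2` valued in dag-n15-c's `V′₁(A′)` literals (`v1GVecInstance` ∕ `v1GVecFamily4`
  over `VecIndexS d L`) carrying the SITE and UNIT layers — operator third by `VectorPiece.ne2PlusOperator_vectorPiece_v1G` (dag-n15-a `s_N15_readingOfRecord₁₂_of_v1G`).
* N16 · NE3 — `InEndRegime ∧ LeafSlot` at node00-def-RR-1's constant layer of record `ne3ConstLayerOfRecord₁₁ F N (ℓ₃ F)`, once per (guarded) family (dag-n16-e).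
* N17 · NE4 — ELIMINATED (`YMDAG.N17.s_N17_of_D4_N18`, inside XXIX).
* N18 · NE5 — at the admissible reading `N18At` IS (dag-n18-d `n18At_readingAdm_iff`, `Iff.rfl`) the two-run inequality
  `|Re E^{(j)}_{S F θ k}(X; g; (ι(T₀ F θ k U), 0)) − Re E^{(j+1)}_{S F θ (k+1)}(πX; b∷g; (ιU, 0))| ≤ C₅·θ₅^j·e^{−κ d_j(X)}` for every ADMISSIBLE run-B field `U` (read
  inside `sp F θ (k+1)`): displayed in stub form (§1 (1)(3)), in closed form at θ (§2), or SUPPLIED from THE END's data — per-member step models with the NODE-A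
  majorant as hypothesis, L01–L03, L07–L10, the located numerals — and the towers' H-layer data `AnalyticH` ∕ `Bound238` ON THE TABLES (§1 (2), dag-n18-d m12 §3 verbatim).
* N22 · NE9 — ELIMINATED given N18 (dag-n22-e module 8a, dag-n22-c's `pairingCoherence_ofRecordAdm` inside): at the canonical home (§1) by
  `YMDAG.N22.s_N22_readingOfRecord₁₂_ofRecordAdm_of_s_N18_analytic` — the junk-freeness pin (J) on the towers beyond the run, the analytic sup-letter (A) for
  `Re E^{(j)}_{S F θ k}(X; g[i ↦ ·]; (ιU, 0))` over ADMISSIBLE run-A fields `U : AdmBg …` and eleven numerals, VERBATIM; at the regime home (§2) by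
  `…On_ofRecordAdm_of_s_N18_stripBound` — (J), twelve numerals and STRIP-(1.18) for the terms of `S F θ k` at the configurations of the reading's OWN table `sp F θ k`,
  VERBATIM, NO readings clause (the readings lie in the tables BY TYPE — the point of the admissible re-key; [I] (1.18) p. 263's regime exactly).
* (D4) — `ReadOutAt D (u3OfRecord₁₂ θ ((ReadingData.ofRecordAdm …).u3Objects θ.γ) k)` (displayed; dag-n17-a `readOutAt_datumOfRecord₁₂_iff_stage10` reads it).
* Spine side — `SRec₁₂ cr` ∕ `SRec₁₂On cr Rg`: N20 `RelWeightBound`, N21 `ShellWeightBound`, the keyed extraction clause, the N19′ `NE7.Core` edge (displayed, as XXVII ∕ XXVIII;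
  no spine reading of record exists; dag-n19-d modules 10 ∕ 15 are the producer-side faces of the edge).

WHAT THIS MODULE PROVES ([bookkeeping]; every theorem ONE application of XXIX with the producers' theorems in the slots).
* §1 CANONICAL HOME ⇒ `Spine ₁₂C`: `spine_rec12C_at_readingAdm₁₂` (N17, N22 eliminated; N18 stub; N16 leaf form; N14 ∕ N15 ∕ (D4) displayed) ·
  `spine_rec12C_at_readingAdm₁₂_of_envelope_bound238` (+ N18 ⟸ dag-n18-d m12 §3, verbatim) · `spine_rec12C_at_readingAdm₁₂_of_v1G` (+ N15 ⟸ dag-n15-a part 32 §4, verbatim).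
* §2 REGIME HOME, any `Rg` ⇒ `Spine` at `IsRecordOfRecord₁₂COn F N Rg`: `spine_rec12COn_at_readingAdm₁₂` (N17, N22 eliminated — STRIP on the own table; N18 in closed form at θ
  over admissible fields).  At
  `Rg := Node00.unityNondeg₁₂ N` and `N = 2` THE ITEM follows by XXVI §6 `spineGivenEndpointR12_of_spine_rec12COn` at the call site (XXVI imports the Theses file; nothing may
  import a Theses importer, so no route-facing twin is filed).  Three named table families already instantiate `(sp, T₀, hT)`: dag-n18-d's plaquette-small tables with the
  transport of record (`admTransport_plaqSmall(_sharp)`, module 13 p485563), node00-def-W1's generated tables (`ReadingData.ofRecordGen`, `hT₀_spGen`, v1.1 p485559),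
  dag-n22-c's space tables of record (module 13).

HONEST FRAMING.  COUNT-NEUTRAL kernel bookkeeping BY NAME at a COMPOSITE node; every node estimate above is a DISPLAYED hypothesis or a producer's displayed
hypothesis carried verbatim; the towers `S`, tables `sp`, gauges, transports `T₀` (with `hT`), letters `li`, `ne2`, `ne1` are θ-keyed DATA inside named containers
(INHABITATION IS NOT CONTENT: termless towers, empty tables — dag-n18-d m12 §5 `s_N18_readingAdm₁₂_of_forall_exists_empty` — and the singleton spine reading make
slots vacuous one at a time; the positive hooks are `AdmBg.nonempty_of_mem` ∕ `Node00.one_mem_spaceI_stage12` and dag-n27-a `coreEdge_singleton_iff_matchingModConstants`);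
no inhabitant of any record class is claimed (K0′ `Record12Inhabited`, stmt-QuantumFields-19902, open; Record 13 pending under director-ym №125's closability gate);
nothing of Bałaban's asserted or instantiated; NE1′–NE9 ∕ NE7 ∕ NE7b ∕ NE7c are NOT PRINTED for d = 4 and NOT PROVED; N27 NOT discharged, K3′ NOT claimed; counts
UNMOVED (typed 28∕28 · discharged 5∕27, A 5∕28); one finite four-torus programme at fixed `ε` — NOT ℝ⁴, NOT infinite volume, NOT OS, NOT a mass gap, NOT Clay.
General-`N` throughout (director-ym №127: nothing here uses `N = 2`).  No decl below carries a cite tag.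
-/

noncomputable section

open Set Metric
open scoped Matrix.Norms.L2Operator

namespace Summit.QuantumFields.YangMills.Theorems.BalabanUVNodesN27SpineRecord

open Literature.MathematicalPhysics.QuantumFieldTheory.Balaban1983to89
open Literature.MathematicalPhysics.QuantumFieldTheory.Balaban1983to89.T4Continuum
open Literature.MathematicalPhysics.QuantumFieldTheory.Balaban1983to89.T4OutputRate (Carriers Functional NE5 DecayBound Window)
open Literature.MathematicalPhysics.QuantumFieldTheory.Balaban1983to89.T4InputCauchyRateData (StepModel)
open Literature.MathematicalPhysics.QuantumFieldTheory.Balaban1983to89.B13Resummation (locE)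
open Literature.MathematicalPhysics.QuantumFieldTheory.Balaban1983to89.TreeLengthTorus (TDom tsys torusTreeLen)
open Literature.MathematicalPhysics.QuantumFieldTheory.Balaban1983to89.TreeLengthTorusGeometry (TTouch)
open Literature.MathematicalPhysics.QuantumFieldTheory.Balaban1983to89.B12TreeDecay (K₀)
open T4ContinuumYM4Torus (ForSmallCouplings)
open Summit.QuantumFields.BalabanUV.T4Continuum.Spine
open Summit.QuantumFields.BalabanUV.T4Continuum.Spine.NE5
open YMDAG.UVSplit
open YMDAG.N18.HLayer
open YMDAG.N18.W1Reading (s_N18_readingAdm₁₂_of_envelope_bound238 n18At_readingAdm_iff)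
open Node00 (Stage12Params datumOfRecord₁₂ IsRecordOfRecord₁₂C IsDatumOfRecord₁₂C NE3Letters₁₁ NE2Objects₁₁ ne3ConstLayerOfRecord₁₁ MatA ιSU prependCoupling)
open Node00.Sect2 (domCount domSys CPair ofBackgroundC)
open Node00.W1 (ReadingData LevelPairing LetterInputs ClusterTower pairOfRecord functionalC termC box SpRestr AdmBg)
open YMDAG.N22 (s_N22_readingOfRecord₁₂_ofRecordAdm_of_s_N18_analytic s_N22_readingOfRecord₁₂On_ofRecordAdm_of_s_N18_stripBound)
open Summit.QuantumFields.YangMills.BalabanUVNodes.N16Regime (InEndRegime)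
open Summit.QuantumFields.YangMills.BalabanUVNodes.N16LeafSlot (LeafSlot)
open Summit.QuantumFields.YangMills.BalabanUVNodes.N16AtRRec12OfRecord (s_N16_rRec₁₂_ofRecord_of_leafSlot)
open Summit.QuantumFields.YangMills.BalabanUVNodes.N16AtRRec12On (s_N16_rRec₁₂On_readingOfRecord₁₂_of_leafSlot)
open Literature.MathematicalPhysics.QuantumFieldTheory.Balaban1983to89.T4EtaRate (NE2PlusSite NE2PlusUnit)
open Summit.QuantumFields.YangMills.BalabanUVNodes.N15.VectorPiece (VecIndexS v1GVecInstance v1GVecFamily4)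
open Summit.QuantumFields.YangMills.BalabanUVNodes.N15.AtRateRecord12V1 (s_N15_readingOfRecord₁₂_of_v1G)

variable {N : ℕ} [NeZero N] (cr : SpineReading₁₂ N)
  (S : (F : T4Family) → (θ : Stage12Params F N) → (k : ℕ) → ClusterTower (F.P k) (MatA N) θ.τ9.M)
  (sp : (F : T4Family) → (θ : Stage12Params F N) → (k j : ℕ) → (domSys (F.P k) θ.τ9.M j).Dom → Set (CPair (F.P k) (MatA N)))
  (gauge : (F : T4Family) → (θ : Stage12Params F N) → (k : ℕ) → GaugeField (F.P k) 0 (Node00.SU N) → GaugeField (F.P k) 0 (Node00.SU N) → ℝ)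
  (hg : ∀ (F : T4Family) (θ : Stage12Params F N) (k : ℕ) (U U' : GaugeField (F.P k) 0 (Node00.SU N)), 0 ≤ gauge F θ k U U')
  (T₀ : (F : T4Family) → (θ : Stage12Params F N) → (k : ℕ) → GaugeField (F.P (k + 1)) 0 (Node00.SU N) → GaugeField (F.P k) 0 (Node00.SU N))
  (hT : ∀ (F : T4Family) (θ : Stage12Params F N) (k : ℕ) (U : GaugeField (F.P (k + 1)) 0 (Node00.SU N)),
    (∀ (j : ℕ) (Y : (domSys (F.P (k + 1)) θ.τ9.M j).Dom), ofBackgroundC (ιSU N) U ∈ sp F θ (k + 1) j Y) →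
      ∀ (j : ℕ) (X : (domSys (F.P k) θ.τ9.M j).Dom), ofBackgroundC (ιSU N) (T₀ F θ k U) ∈ sp F θ k j X)
  (li : (F : T4Family) → Stage12Params F N → LetterInputs) (ℓ₃ : T4Family → NE3Letters₁₁)
  (ne2 : (F : T4Family) → Stage12Params F N → (ℕ → ℝ) → List (ULoop F) → ℕ → NE2Objects₁₁)
  (ne1 : (F : T4Family) → Stage12Params F N → (ℕ → ℝ) → List (ULoop F) → NE1pCarriers)

/-! ## §1 The canonical home at the admissible reading of record -/

section Canonical

/-- **N27 = B5 AT THE STAGE-12 RECORD FROM THE SLOTS AT THE CANONICAL HOME OF THE ADMISSIBLE READING OF RECORD — N17 AND N22 ELIMINATED, N18 IN STUB FORM**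
(XXIX `spine_rec12C_at_readingOfRecord₁₂` at `w1 := fun F θ ↦ ReadingData.ofRecordAdm F θ.τ9.M N (S F θ) (sp F θ) (gauge F θ) (hg F θ) (T₀ F θ) (hT F θ) (li F θ)`).
Rate side: NE1′ on `ne1` and NE2 on `ne2` read at the datum key's parameter `h.params` (displayed); NE3 as `InEndRegime ∧ LeafSlot` at RR-1's layer once per family
(dag-n16-e `s_N16_rRec₁₂_ofRecord_of_leafSlot`); N18 in stub form `S_N18 (RRec₁₂ 𝔯_adm)` — dag-n18-d's home verbatim, producers `YMDAG.N18.W1Reading.s_N18_readingAdm₁₂_of_envelope_bound238`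
(§1 (2) below) ∕ `_of_forall` ∕ `_of_allFields`; N22 ELIMINATED given `h18` by dag-n22-e's `YMDAG.N22.s_N22_readingOfRecord₁₂_ofRecordAdm_of_s_N18_analytic` (module 8a) —
its junk-freeness pin (J), analytic letter (A) over ADMISSIBLE run-A fields and eleven numerals carried VERBATIM; (D4) on the admissible bundles (displayed).  Spine side:
N20 ∕ N21 ∕ the keyed extraction clause at `SRec₁₂ cr` and the home-keyed N19′ `NE7.Core` edge (displayed, as XXVII).  Every hypothesis 0∕1 today. [bookkeeping] -/
theorem spine_rec12C_at_readingAdm₁₂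
    (h14 : ∀ (F : T4Family) (D : Datum F N) (h : IsDatumOfRecord₁₂C F N D) (g₀ : ℕ → ℝ) (os : List (ULoop F)), N14At (ne1 F h.params g₀ os))
    (h15 : ∀ (F : T4Family) (D : Datum F N) (h : IsDatumOfRecord₁₂C F N D) (g₀ : ℕ → ℝ) (os : List (ULoop F)) (k : ℕ),
      N15At (ne2OfRecord₁₁ (ne2 F h.params g₀ os k)))
    (h16 : ∀ (F : T4Family), (∃ D : Datum F N, IsDatumOfRecord₁₂C F N D) →
      InEndRegime (ne3OfRecord₁₁ F (ne3ConstLayerOfRecord₁₁ F N (ℓ₃ F))) ∧ LeafSlot (ne3OfRecord₁₁ F (ne3ConstLayerOfRecord₁₁ F N (ℓ₃ F))))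
    (h18 : S_N18 (RRec₁₂ (readingOfRecord₁₂
      (fun F θ => ReadingData.ofRecordAdm F θ.τ9.M N (S F θ) (sp F θ) (gauge F θ) (hg F θ) (T₀ F θ) (hT F θ) (li F θ)) ℓ₃ ne2 ne1)))
    -- N22 ⟸ N18 (dag-n22-e module 8a, analytic sup-letter currency): (J), (A) over ADMISSIBLE run-A fields, eleven numerals — verbatim
    (hjunk : ∀ (F : T4Family) (θ : Stage12Params F N), θ.Provisos₁₂ F N → θ.Admissible F N →
      ∀ (k : ℕ) (X : Node00.W1.Dom (F.P k) θ.τ9.M), k < X.1 → ∀ (g : ℕ → ℝ) (φ : CPair (F.P k) (MatA N)), functionalC (S F θ k) g φ X = 0)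
    (hA : ∀ (F : T4Family) (θ : Stage12Params F N), θ.Provisos₁₂ F N → θ.Admissible F N → ∀ (k : ℕ),
      ∀ g ∈ Window θ.γ, ∀ (U : AdmBg F θ.τ9.M N (sp F θ) k) (X : Node00.W1.Dom (F.P k) θ.τ9.M) (i : ℕ), i < X.1 →
        ∃ (Fz : ℂ → ℂ) (Dset : Set ℂ), DifferentiableOn ℂ Fz Dset ∧
          (∀ z ∈ Dset, ‖Fz z‖ ≤ (li F θ).A * (li F θ).μ ^ (X.1 - 1 - i) * Real.exp (-((li F θ).κ * (domSys (F.P k) θ.τ9.M X.1).dj X.2))) ∧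
          (∀ t ∈ Ioc (0 : ℝ) θ.γ, closedBall (t : ℂ) (li F θ).r ⊆ Dset) ∧
          (∀ t ∈ Ioc (0 : ℝ) θ.γ, Fz t = ((functionalC (S F θ k) (Function.update g i t) (ofBackgroundC (ιSU N) U.1) X).re : ℂ)))
    (hnum : ∀ (F : T4Family) (θ : Stage12Params F N), θ.Provisos₁₂ F N → θ.Admissible F N →
      0 < (li F θ).C₀ ∧ 0 < (li F θ).θ₅ ∧ (li F θ).θ₅ < 1 ∧ 0 ≤ (li F θ).C₅ ∧ 2 * (li F θ).C₅ / (1 - (li F θ).θ₅) ≤ (li F θ).C₀ ∧ 0 < (li F θ).A ∧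
        (li F θ).θ₅ ≤ (li F θ).μ ∧ (li F θ).C₀ ≤ 2 * (li F θ).A ∧ 0 < (li F θ).r ∧ 0 < (li F θ).s ∧ (li F θ).s < 1)
    (hD4 : ∀ (F : T4Family) (D : Datum F N) (h : IsDatumOfRecord₁₂C F N D) (k : ℕ), ReadOutAt D (u3OfRecord₁₂ h.params
      ((ReadingData.ofRecordAdm F h.params.τ9.M N (S F h.params) (sp F h.params) (gauge F h.params) (hg F h.params) (T₀ F h.params) (hT F h.params)
        (li F h.params)).u3Objects h.params.γ) k))
    (hx' : S_N27x (fun F D w => IsRecordOfRecord₁₂C F N D w) (SRec₁₂ cr)) (h20 : S_N20 (SRec₁₂ cr)) (h21 : S_N21 (SRec₁₂ cr))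
    (h19 : ∀ (F : T4Family) (θ : Stage12Params F N) (hP : θ.Provisos₁₂ F N), θ.Admissible F N → ∀ (g₀ : ℕ → ℝ) (os : List (ULoop F))
      (h : IsDatumOfRecord₁₂C F N (datumOfRecord₁₂ F N θ hP)) (k : ℕ),
      RatesAt (datumOfRecord₁₂ F N θ hP) (rateCarriersOfRecord₁₂ (readingOfRecord₁₂
        (fun F θ => ReadingData.ofRecordAdm F θ.τ9.M N (S F θ) (sp F θ) (gauge F θ) (hg F θ) (T₀ F θ) (hT F θ) (li F θ)) ℓ₃ ne2 ne1)
          F h.params h.provisos g₀ os k) → letI := (cr F θ hP g₀ os).dec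
        ∃ δ : ℕ → ℝ, NE7.Core (cr F θ hP g₀ os).l₀ (cr F θ hP g₀ os).vol (cr F θ hP g₀ os).T (cr F θ hP g₀ os).Bad
          (fun K t τ => (cr F θ hP g₀ os).A K t τ - (cr F θ hP g₀ os).shA K t τ) (fun K t τ => (cr F θ hP g₀ os).B K t τ - (cr F θ hP g₀ os).shB K t τ) δ ∧
          Summable δ) :
    Spine (N := N) fun F D w => IsRecordOfRecord₁₂C F N D w :=
  spine_rec12C_at_readingOfRecord₁₂ cr _ ℓ₃ ne2 ne1 ((s_N14_readingOfRecord₁₂_iff _ ℓ₃ ne2 ne1).mpr h14) ((s_N15_readingOfRecord₁₂_iff _ ℓ₃ ne2 ne1).mpr h15)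
    (s_N16_rRec₁₂_ofRecord_of_leafSlot (readingOfRecord₁₂ _ ℓ₃ ne2 ne1) ℓ₃ (fun _ _ _ _ _ _ => rfl) h16) h18
    (s_N22_readingOfRecord₁₂_ofRecordAdm_of_s_N18_analytic S sp gauge hg T₀ hT li ℓ₃ ne2 ne1 h18 hjunk hA hnum)
    ((s_D4_readingOfRecord₁₂_iff _ ℓ₃ ne2 ne1).mpr hD4) hx' h20 h21 h19

open Classical in
/-- **… WITH N18 SUPPLIED FROM THE END's (2.38)-ENVELOPE DATA AND THE TOWERS' H-LAYER DATA ON THE TABLES, BY NAME** (dag-n18-d module 12 §3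
`YMDAG.N18.W1Reading.s_N18_readingAdm₁₂_of_envelope_bound238`, hypothesis VERBATIM): at every admissible Stage-12 tuple with provisos and every run length `k` — (i) THE END's data
over the carriers of the ADMISSIBLE level pairing (per-member step models representing (2.13) of activities on the `k`-th torus's catalogue with the NODE-A majorant AS HYPOTHESIS at
`C₃ε₁`, L01–L03 on the functionals, L07 ∕ L08, the W3 shapes L09aff ∕ blind ∕ hom ∕ unit, the located numerals, L10, the sharp clause), (ii) the towers' H-layer data in the
configuration direction ON THE TABLES `sp F θ k` ∕ `sp F θ (k+1)` (restriction-closed, `AnalyticH` + `Bound238` at every step, amplitudes `A_A ∕ A_B`, the two STRICT [KP86]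
clauses), (iii) the reading's letters `li F θ` dominating THE END's — NO embedding clause, NO pairing clause (dag-n18-d: discharged BY TYPE at the admissible pairing).
The N18 slot of K3′'s rate side is thereby a sentence about THE END's objects and the towers of record on their tables, and N22 follows from it (module 8a). [bookkeeping] -/
theorem spine_rec12C_at_readingAdm₁₂_of_envelope_bound238
    (h14 : ∀ (F : T4Family) (D : Datum F N) (h : IsDatumOfRecord₁₂C F N D) (g₀ : ℕ → ℝ) (os : List (ULoop F)), N14At (ne1 F h.params g₀ os))
    (h15 : ∀ (F : T4Family) (D : Datum F N) (h : IsDatumOfRecord₁₂C F N D) (g₀ : ℕ → ℝ) (os : List (ULoop F)) (k : ℕ),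
      N15At (ne2OfRecord₁₁ (ne2 F h.params g₀ os k)))
    (h16 : ∀ (F : T4Family), (∃ D : Datum F N, IsDatumOfRecord₁₂C F N D) →
      InEndRegime (ne3OfRecord₁₁ F (ne3ConstLayerOfRecord₁₁ F N (ℓ₃ F))) ∧ LeafSlot (ne3OfRecord₁₁ F (ne3ConstLayerOfRecord₁₁ F N (ℓ₃ F))))
    (h18 : ∀ (F : T4Family) (θ : Stage12Params F N), θ.Provisos₁₂ F N → θ.Admissible F N → ∀ k : ℕ,
      ∃ (Op : Type) (_ : NormedAddCommGroup Op) (_ : NormedSpace ℂ Op) (Hist : Type) (_ : NormedAddCommGroup Hist) (_ : NormedSpace ℂ Hist)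
        (Mb : ℝ → StepModel (LevelPairing.ofRecordAdm F θ.τ9.M N k (sp F θ) (gauge F θ k) (hg F θ k) (T₀ F θ k) (hT F θ k)).carriers Op Hist)
        (act : ℝ → (j : ℕ) → Op × Hist → TDom 4 (domCount (F.P k) θ.τ9.M j) → ℂ) (γ' C3 ε₁ Rd κ A_A A_B E₁ δ δ' θr θ' cH ω ρ₀ B : ℝ) (k₀ : ℕ),
        (∀ b : ℝ, 0 < b → b ≤ γ' → ∀ (X : Node00.W1.Dom (F.P k) θ.τ9.M) (z : Op × Hist),
          (Mb b).Out X.1 z.1 z.2 X =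
            locE (TTouch (d := 4) (N := domCount (F.P k) θ.τ9.M X.1)) (fun Z : (tsys 4 (domCount (F.P k) θ.τ9.M X.1)).Dom => Z.1)
              (act b X.1 z) X.2.1) ∧
        0 ≤ C3 ∧ 0 ≤ ε₁ ∧ 0 ≤ κ ∧ κ + 2 * (64 * Real.log 162) + 2 ≤ Rd ∧
        C3 * ε₁ * Real.exp (5 * κ + 1) * K₀ 64 8 * 9 * 64 ≤ 1 ∧
        (∀ b : ℝ, 0 < b → b ≤ γ' → ∀ j, ∀ g ∈ Window γ',
          ∀ (U : (LevelPairing.ofRecordAdm F θ.τ9.M N k (sp F θ) (gauge F θ k) (hg F θ k) (T₀ F θ k) (hT F θ k)).BgB) (q : Op × Hist),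
          q ∈ (Mb b).Base j g U →
          ∃ V : Set (Op × Hist), IsOpen V ∧ (Mb b).box j q ⊆ V ∧
            (∀ Z : TDom 4 (domCount (F.P k) θ.τ9.M j), DifferentiableOn ℂ (fun z : Op × Hist => act b j z Z) V) ∧
            (∀ z ∈ V, ∀ Z : TDom 4 (domCount (F.P k) θ.τ9.M j), ‖act b j z Z‖ ≤ C3 * ε₁ * Real.exp (-(Rd * torusTreeLen Z.1)))) ∧
        (∀ b : ℝ, 0 < b → b ≤ γ' → L01 (Mb b)
          ((LevelPairing.ofRecordAdm F θ.τ9.M N k (sp F θ) (gauge F θ k) (hg F θ k) (T₀ F θ k) (hT F θ k)).EA (S F θ k)) (Window γ')) ∧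
        (∀ b : ℝ, 0 < b → b ≤ γ' → L02 (Mb b)
          ((LevelPairing.ofRecordAdm F θ.τ9.M N k (sp F θ) (gauge F θ k) (hg F θ k) (T₀ F θ k) (hT F θ k)).EB (S F θ (k + 1)) b)
          (Window γ')) ∧
        (∀ b : ℝ, 0 < b → b ≤ γ' → L03 (Mb b)
          ((LevelPairing.ofRecordAdm F θ.τ9.M N k (sp F θ) (gauge F θ k) (hg F θ k) (T₀ F θ k) (hT F θ k)).EB (S F θ (k + 1)) b)
          (Window γ')) ∧
        (∀ b : ℝ, 0 < b → b ≤ γ' → L07 (Mb b) (Window γ') δ θr) ∧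
        (∀ b : ℝ, 0 < b → b ≤ γ' → L08 (Mb b) (Window γ') κ (Real.exp 1 * 9 * 64 * K₀ 64 8 ^ 2 * A_B) δ' θr) ∧
        (∀ b : ℝ, 0 < b → b ≤ γ' → L09aff (Mb b) (Window γ')) ∧ (∀ b : ℝ, 0 < b → b ≤ γ' → L09blind (Mb b) (Window γ')) ∧
        (∀ b : ℝ, 0 < b → b ≤ γ' → L09hom (Mb b) (Window γ')) ∧ (∀ b : ℝ, 0 < b → b ≤ γ' → L09unit (Mb b) (Window γ') κ E₁ cH ω) ∧
        0 < E₁ ∧ 0 ≤ δ + δ' ∧ 0 ≤ θr ∧ θr ≤ θ' ∧ θ' ≤ 1 ∧ 0 ≤ cH ∧ 0 < ω ∧ ρ₀ < 1 ∧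
        (δ + δ') * θr ^ k₀ +
            cH * (Real.exp 1 * 9 * 64 * K₀ 64 8 ^ 2 * A_A + Real.exp 1 * 9 * 64 * K₀ 64 8 ^ 2 * A_B) / (1 - ω) ≤ ρ₀ ∧
        0 ≤ B ∧ (∀ k < k₀, Real.exp 1 * 9 * 64 * K₀ 64 8 ^ 2 * A_A + Real.exp 1 * 9 * 64 * K₀ 64 8 ^ 2 * A_B ≤ B * θr ^ k) ∧
        Real.exp 1 * 9 * 64 * K₀ 64 8 ^ 2 * C3 * cH * ε₁ < (θ' - ω) * (1 - ρ₀) ∧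
        (∀ m, SpRestr (sp F θ k (m + 1))) ∧
        (∀ m, (S F θ k m).AnalyticH (box γ' m) (sp F θ k (m + 1))) ∧ (∀ m, (S F θ k m).Bound238 (box γ' m) (sp F θ k (m + 1)) A_A Rd) ∧ 0 ≤ A_A ∧
        A_A * Real.exp (5 * κ + 1) * K₀ 64 8 * 9 * 64 < 1 ∧
        (∀ m, SpRestr (sp F θ (k + 1) (m + 1))) ∧
        (∀ m, (S F θ (k + 1) m).AnalyticH (box γ' m) (sp F θ (k + 1) (m + 1))) ∧
        (∀ m, (S F θ (k + 1) m).Bound238 (box γ' m) (sp F θ (k + 1) (m + 1)) A_B Rd) ∧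
        0 ≤ A_B ∧ A_B * Real.exp (5 * κ + 1) * K₀ 64 8 * 9 * 64 < 1 ∧
        θ.γ ≤ γ' ∧ (li F θ).κ ≤ κ ∧ θ' ≤ (li F θ).θ₅ ∧
        (Real.exp 1 * 9 * 64 * K₀ 64 8 ^ 2 * (C3 * ε₁) / (1 - ρ₀) * (δ + δ') + B) * (θ' - ω) /
            (θ' - (ω + Real.exp 1 * 9 * 64 * K₀ 64 8 ^ 2 * (C3 * ε₁) / (1 - ρ₀) * cH)) ≤ (li F θ).C₅)
    -- N22 ⟸ N18 (dag-n22-e module 8a, analytic sup-letter currency): (J), (A) over ADMISSIBLE run-A fields, eleven numerals — verbatim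
    (hjunk : ∀ (F : T4Family) (θ : Stage12Params F N), θ.Provisos₁₂ F N → θ.Admissible F N →
      ∀ (k : ℕ) (X : Node00.W1.Dom (F.P k) θ.τ9.M), k < X.1 → ∀ (g : ℕ → ℝ) (φ : CPair (F.P k) (MatA N)), functionalC (S F θ k) g φ X = 0)
    (hA : ∀ (F : T4Family) (θ : Stage12Params F N), θ.Provisos₁₂ F N → θ.Admissible F N → ∀ (k : ℕ),
      ∀ g ∈ Window θ.γ, ∀ (U : AdmBg F θ.τ9.M N (sp F θ) k) (X : Node00.W1.Dom (F.P k) θ.τ9.M) (i : ℕ), i < X.1 →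
        ∃ (Fz : ℂ → ℂ) (Dset : Set ℂ), DifferentiableOn ℂ Fz Dset ∧
          (∀ z ∈ Dset, ‖Fz z‖ ≤ (li F θ).A * (li F θ).μ ^ (X.1 - 1 - i) * Real.exp (-((li F θ).κ * (domSys (F.P k) θ.τ9.M X.1).dj X.2))) ∧
          (∀ t ∈ Ioc (0 : ℝ) θ.γ, closedBall (t : ℂ) (li F θ).r ⊆ Dset) ∧
          (∀ t ∈ Ioc (0 : ℝ) θ.γ, Fz t = ((functionalC (S F θ k) (Function.update g i t) (ofBackgroundC (ιSU N) U.1) X).re : ℂ)))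
    (hnum : ∀ (F : T4Family) (θ : Stage12Params F N), θ.Provisos₁₂ F N → θ.Admissible F N →
      0 < (li F θ).C₀ ∧ 0 < (li F θ).θ₅ ∧ (li F θ).θ₅ < 1 ∧ 0 ≤ (li F θ).C₅ ∧ 2 * (li F θ).C₅ / (1 - (li F θ).θ₅) ≤ (li F θ).C₀ ∧ 0 < (li F θ).A ∧
        (li F θ).θ₅ ≤ (li F θ).μ ∧ (li F θ).C₀ ≤ 2 * (li F θ).A ∧ 0 < (li F θ).r ∧ 0 < (li F θ).s ∧ (li F θ).s < 1)
    (hD4 : ∀ (F : T4Family) (D : Datum F N) (h : IsDatumOfRecord₁₂C F N D) (k : ℕ), ReadOutAt D (u3OfRecord₁₂ h.params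
      ((ReadingData.ofRecordAdm F h.params.τ9.M N (S F h.params) (sp F h.params) (gauge F h.params) (hg F h.params) (T₀ F h.params) (hT F h.params)
        (li F h.params)).u3Objects h.params.γ) k))
    (hx' : S_N27x (fun F D w => IsRecordOfRecord₁₂C F N D w) (SRec₁₂ cr)) (h20 : S_N20 (SRec₁₂ cr)) (h21 : S_N21 (SRec₁₂ cr))
    (h19 : ∀ (F : T4Family) (θ : Stage12Params F N) (hP : θ.Provisos₁₂ F N), θ.Admissible F N → ∀ (g₀ : ℕ → ℝ) (os : List (ULoop F))
      (h : IsDatumOfRecord₁₂C F N (datumOfRecord₁₂ F N θ hP)) (k : ℕ),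
      RatesAt (datumOfRecord₁₂ F N θ hP) (rateCarriersOfRecord₁₂ (readingOfRecord₁₂
        (fun F θ => ReadingData.ofRecordAdm F θ.τ9.M N (S F θ) (sp F θ) (gauge F θ) (hg F θ) (T₀ F θ) (hT F θ) (li F θ)) ℓ₃ ne2 ne1)
          F h.params h.provisos g₀ os k) → letI := (cr F θ hP g₀ os).dec
        ∃ δ : ℕ → ℝ, NE7.Core (cr F θ hP g₀ os).l₀ (cr F θ hP g₀ os).vol (cr F θ hP g₀ os).T (cr F θ hP g₀ os).Bad
          (fun K t τ => (cr F θ hP g₀ os).A K t τ - (cr F θ hP g₀ os).shA K t τ) (fun K t τ => (cr F θ hP g₀ os).B K t τ - (cr F θ hP g₀ os).shB K t τ) δ ∧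
          Summable δ) :
    Spine (N := N) fun F D w => IsRecordOfRecord₁₂C F N D w :=
  spine_rec12C_at_readingAdm₁₂ cr S sp gauge hg T₀ hT li ℓ₃ ne2 ne1 h14 h15 h16
    (s_N18_readingAdm₁₂_of_envelope_bound238 S sp gauge hg T₀ hT li ℓ₃ ne2 ne1 h18) hjunk hA hnum hD4 hx' h20 h21 h19

/-- **… WITH N15 SUPPLIED FROM dag-n15-c's `V′₁(A′)`-LIVE VECTOR-PIECE FAMILY, BY NAME** (dag-n15-a part 32
`N15.AtRateRecord12V1.s_N15_readingOfRecord₁₂_of_v1G`, hypothesis verbatim: the residual layer `ne2` takes `V′₁(A′)` literals as values — gauge field `A′` itself as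
the datum, index `VecIndexS d L`, instances `v1GVecInstance`, kernels `v1GVecFamily4` — carrying the SITE and UNIT layers; the OPERATOR third is dag-n15-c's
`VectorPiece.ne2PlusOperator_vectorPiece_v1G`, NOT a hypothesis). [bookkeeping] -/
theorem spine_rec12C_at_readingAdm₁₂_of_v1G {d L : ℕ} [NeZero L] {ι : Type} [Fintype ι] [DecidableEq ι] {𝔄 : Type} [NormedRing 𝔄] [NormedAlgebra ℝ 𝔄]
    [CompleteSpace 𝔄] (e : 𝔄 ≃L[ℝ] (ι → ℝ)) (hd : 1 ≤ d) (hL : 1 ≤ L)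
    (h14 : ∀ (F : T4Family) (D : Datum F N) (h : IsDatumOfRecord₁₂C F N D) (g₀ : ℕ → ℝ) (os : List (ULoop F)), N14At (ne1 F h.params g₀ os))
    (h15 : ∀ (F : T4Family) (θ : Stage12Params F N), θ.Provisos₁₂ F N → ∀ (g₀ : ℕ → ℝ) (os : List (ULoop F)) (k : ℕ),
      ∃ (c35 p : ℝ) (Ksite Kunit : ∀ j : VecIndexS d L, B9.SiteKernel (v1GVecInstance (d := d) 𝔄 ι L hL j).gc (v1GVecInstance (d := d) 𝔄 ι L hL j).Bf)
        (inΛ : ∀ j : VecIndexS d L, (v1GVecInstance (d := d) 𝔄 ι L hL j).gc.Site → Prop)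
        (unitDist : ∀ j : VecIndexS d L, (v1GVecInstance (d := d) 𝔄 ι L hL j).gc.Site → (v1GVecInstance (d := d) 𝔄 ι L hL j).gc.Site → ℝ),
        0 < c35 ∧
        ne2 F θ g₀ os k =
          { I := VecIndexS d L, c35 := c35, p := p, pi := v1GVecInstance (d := d) 𝔄 ι L hL, Kop := v1GVecFamily4 (d := d) 𝔄 ι e L hL,
            Ksite := Ksite, Kunit := Kunit, inΛ := inΛ, unitDist := unitDist } ∧
        NE2PlusSite 4 p c35 (v1GVecInstance (d := d) 𝔄 ι L hL) Ksite ∧ NE2PlusUnit c35 (v1GVecInstance (d := d) 𝔄 ι L hL) Kunit inΛ unitDist)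
    (h16 : ∀ (F : T4Family), (∃ D : Datum F N, IsDatumOfRecord₁₂C F N D) →
      InEndRegime (ne3OfRecord₁₁ F (ne3ConstLayerOfRecord₁₁ F N (ℓ₃ F))) ∧ LeafSlot (ne3OfRecord₁₁ F (ne3ConstLayerOfRecord₁₁ F N (ℓ₃ F))))
    (h18 : S_N18 (RRec₁₂ (readingOfRecord₁₂
      (fun F θ => ReadingData.ofRecordAdm F θ.τ9.M N (S F θ) (sp F θ) (gauge F θ) (hg F θ) (T₀ F θ) (hT F θ) (li F θ)) ℓ₃ ne2 ne1)))
    -- N22 ⟸ N18 (dag-n22-e module 8a, analytic sup-letter currency): (J), (A) over ADMISSIBLE run-A fields, eleven numerals — verbatim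
    (hjunk : ∀ (F : T4Family) (θ : Stage12Params F N), θ.Provisos₁₂ F N → θ.Admissible F N →
      ∀ (k : ℕ) (X : Node00.W1.Dom (F.P k) θ.τ9.M), k < X.1 → ∀ (g : ℕ → ℝ) (φ : CPair (F.P k) (MatA N)), functionalC (S F θ k) g φ X = 0)
    (hA : ∀ (F : T4Family) (θ : Stage12Params F N), θ.Provisos₁₂ F N → θ.Admissible F N → ∀ (k : ℕ),
      ∀ g ∈ Window θ.γ, ∀ (U : AdmBg F θ.τ9.M N (sp F θ) k) (X : Node00.W1.Dom (F.P k) θ.τ9.M) (i : ℕ), i < X.1 →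
        ∃ (Fz : ℂ → ℂ) (Dset : Set ℂ), DifferentiableOn ℂ Fz Dset ∧
          (∀ z ∈ Dset, ‖Fz z‖ ≤ (li F θ).A * (li F θ).μ ^ (X.1 - 1 - i) * Real.exp (-((li F θ).κ * (domSys (F.P k) θ.τ9.M X.1).dj X.2))) ∧
          (∀ t ∈ Ioc (0 : ℝ) θ.γ, closedBall (t : ℂ) (li F θ).r ⊆ Dset) ∧
          (∀ t ∈ Ioc (0 : ℝ) θ.γ, Fz t = ((functionalC (S F θ k) (Function.update g i t) (ofBackgroundC (ιSU N) U.1) X).re : ℂ)))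
    (hnum : ∀ (F : T4Family) (θ : Stage12Params F N), θ.Provisos₁₂ F N → θ.Admissible F N →
      0 < (li F θ).C₀ ∧ 0 < (li F θ).θ₅ ∧ (li F θ).θ₅ < 1 ∧ 0 ≤ (li F θ).C₅ ∧ 2 * (li F θ).C₅ / (1 - (li F θ).θ₅) ≤ (li F θ).C₀ ∧ 0 < (li F θ).A ∧
        (li F θ).θ₅ ≤ (li F θ).μ ∧ (li F θ).C₀ ≤ 2 * (li F θ).A ∧ 0 < (li F θ).r ∧ 0 < (li F θ).s ∧ (li F θ).s < 1)
    (hD4 : ∀ (F : T4Family) (D : Datum F N) (h : IsDatumOfRecord₁₂C F N D) (k : ℕ), ReadOutAt D (u3OfRecord₁₂ h.params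
      ((ReadingData.ofRecordAdm F h.params.τ9.M N (S F h.params) (sp F h.params) (gauge F h.params) (hg F h.params) (T₀ F h.params) (hT F h.params)
        (li F h.params)).u3Objects h.params.γ) k))
    (hx' : S_N27x (fun F D w => IsRecordOfRecord₁₂C F N D w) (SRec₁₂ cr)) (h20 : S_N20 (SRec₁₂ cr)) (h21 : S_N21 (SRec₁₂ cr))
    (h19 : ∀ (F : T4Family) (θ : Stage12Params F N) (hP : θ.Provisos₁₂ F N), θ.Admissible F N → ∀ (g₀ : ℕ → ℝ) (os : List (ULoop F))
      (h : IsDatumOfRecord₁₂C F N (datumOfRecord₁₂ F N θ hP)) (k : ℕ),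
      RatesAt (datumOfRecord₁₂ F N θ hP) (rateCarriersOfRecord₁₂ (readingOfRecord₁₂
        (fun F θ => ReadingData.ofRecordAdm F θ.τ9.M N (S F θ) (sp F θ) (gauge F θ) (hg F θ) (T₀ F θ) (hT F θ) (li F θ)) ℓ₃ ne2 ne1)
          F h.params h.provisos g₀ os k) → letI := (cr F θ hP g₀ os).dec
        ∃ δ : ℕ → ℝ, NE7.Core (cr F θ hP g₀ os).l₀ (cr F θ hP g₀ os).vol (cr F θ hP g₀ os).T (cr F θ hP g₀ os).Bad
          (fun K t τ => (cr F θ hP g₀ os).A K t τ - (cr F θ hP g₀ os).shA K t τ) (fun K t τ => (cr F θ hP g₀ os).B K t τ - (cr F θ hP g₀ os).shB K t τ) δ ∧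
          Summable δ) :
    Spine (N := N) fun F D w => IsRecordOfRecord₁₂C F N D w :=
  spine_rec12C_at_readingOfRecord₁₂ cr _ ℓ₃ ne2 ne1 ((s_N14_readingOfRecord₁₂_iff _ ℓ₃ ne2 ne1).mpr h14) (s_N15_readingOfRecord₁₂_of_v1G e _ ℓ₃ ne2 ne1 hd hL h15)
    (s_N16_rRec₁₂_ofRecord_of_leafSlot (readingOfRecord₁₂ _ ℓ₃ ne2 ne1) ℓ₃ (fun _ _ _ _ _ _ => rfl) h16) h18
    (s_N22_readingOfRecord₁₂_ofRecordAdm_of_s_N18_analytic S sp gauge hg T₀ hT li ℓ₃ ne2 ne1 h18 hjunk hA hnum)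
    ((s_D4_readingOfRecord₁₂_iff _ ℓ₃ ne2 ne1).mpr hD4) hx' h20 h21 h19

end Canonical

/-! ## §2 The regime-restricted home at the admissible reading of record, any regime `Rg` -/

section Regime

variable (Rg : (F : T4Family) → Stage12Params F N → Prop)

/-- **N27 = B5 AT THE REGIME RECORD CLASS `IsRecordOfRecord₁₂COn F N Rg` FROM THE SLOTS AT THE REGIME HOME OF THE ADMISSIBLE READING OF RECORD, ANY `Rg` — N17 AND N22
ELIMINATED, N18 IN CLOSED FORM AT θ** (XXIX `spine_rec12COn_at_readingOfRecord₁₂` at the admissible `w1`).  For every family and every Stage-12 tuple `θ` with provisos IN THE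
REGIME, admissible: NE1′ on `ne1 F θ g₀ os`, NE2 on `ne2 F θ g₀ os k` (displayed); NE3 as `InEndRegime ∧ LeafSlot` once per guarded family (dag-n16-e
`s_N16_rRec₁₂On_readingOfRecord₁₂_of_leafSlot`); N18 DISPLAYED IN CLOSED FORM (dag-n18-d `n18At_readingAdm_iff`, `Iff.rfl`): for every run length `k`, member `b ∈ ]0, θ.γ]`, history
`g ∈ ]0, θ.γ]^ℕ`, every ADMISSIBLE run-B gauge field `U` of the `(k+1)`-th torus — read inside the table `sp F θ (k+1)` — and run-A domain `(j, X)`,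
`|Re E^{(j)}_{S F θ k}(X; g; (ι(T₀ F θ k U), 0)) − Re E^{(j+1)}_{S F θ (k+1)}(πX; b∷g; (ιU, 0))| ≤ C₅·θ₅^j·e^{−κ d_j(X)}` with the letters `li F θ` (= [I] (1.18)'s regime exactly);
N22 ELIMINATED given N18 by dag-n22-e's regime edge `YMDAG.N22.s_N22_readingOfRecord₁₂On_ofRecordAdm_of_s_N18_stripBound` (module 8a) in the STRIP currency on the
reading's OWN table `sp F θ k` — (J), twelve numerals and STRIP-(1.18) for the terms `E^{(j)}_{S F θ k}(Y; g[i ↦ ·]; ψ)` at the configurations `ψ ∈ sp F θ k j Y` carried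
VERBATIM, NO readings clause (BY TYPE at the admissible reading); (D4) on the admissible bundles at θ (displayed).
Spine side: N20 ∕ N21 at `SRec₁₂On cr Rg`, the guarded keyed extraction clause, the same-tuple all-run-lengths N19′ edge (displayed, as XXVIII).  At `Rg := Node00.unityNondeg₁₂ N`,
`N = 2` THE ITEM is XXVI §6 `spineGivenEndpointR12_of_spine_rec12COn` of this. [bookkeeping] -/
theorem spine_rec12COn_at_readingAdm₁₂
    (h14 : ∀ (F : T4Family) (θ : Stage12Params F N), θ.Provisos₁₂ F N → Rg F θ → θ.Admissible F N → ∀ (g₀ : ℕ → ℝ) (os : List (ULoop F)),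
      N14At (ne1 F θ g₀ os))
    (h15 : ∀ (F : T4Family) (θ : Stage12Params F N), θ.Provisos₁₂ F N → Rg F θ → θ.Admissible F N → ∀ (g₀ : ℕ → ℝ) (os : List (ULoop F)) (k : ℕ),
      N15At (ne2OfRecord₁₁ (ne2 F θ g₀ os k)))
    (h16 : ∀ (F : T4Family), (∃ θ : Stage12Params F N, θ.Provisos₁₂ F N ∧ Rg F θ ∧ θ.Admissible F N) →
      InEndRegime (ne3OfRecord₁₁ F (ne3ConstLayerOfRecord₁₁ F N (ℓ₃ F))) ∧ LeafSlot (ne3OfRecord₁₁ F (ne3ConstLayerOfRecord₁₁ F N (ℓ₃ F))))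
    (h18 : ∀ (F : T4Family) (θ : Stage12Params F N), θ.Provisos₁₂ F N → Rg F θ → θ.Admissible F N → ∀ (k : ℕ) (b : ℝ), 0 < b → b ≤ θ.γ →
      ∀ g ∈ Window θ.γ,
        ∀ (U : {U : GaugeField (F.P (k + 1)) 0 (Node00.SU N) //
            ∀ (j : ℕ) (Y : (domSys (F.P (k + 1)) θ.τ9.M j).Dom), ofBackgroundC (ιSU N) U ∈ sp F θ (k + 1) j Y})
          (X : Node00.W1.Dom (F.P k) θ.τ9.M),
        |(functionalC (S F θ k) g (ofBackgroundC (ιSU N) (T₀ F θ k U.1)) X).re -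
            (functionalC (S F θ (k + 1)) (prependCoupling b g) (ofBackgroundC (ιSU N) U.1) (pairOfRecord F θ.τ9.M k X)).re| ≤
          (li F θ).C₅ * (li F θ).θ₅ ^ X.1 * Real.exp (-((li F θ).κ * (domSys (F.P k) θ.τ9.M X.1).dj X.2)))
    -- N22 ⟸ N18 (dag-n22-e module 8a, STRIP currency on the reading's OWN table, NO readings clause): (J), twelve numerals, STRIP-(1.18) — verbatim
    (hjunk : ∀ (F : T4Family) (θ : Stage12Params F N), θ.Provisos₁₂ F N → Rg F θ → θ.Admissible F N →
      ∀ (k : ℕ) (X : Node00.W1.Dom (F.P k) θ.τ9.M), k < X.1 → ∀ (g : ℕ → ℝ) (φ : CPair (F.P k) (MatA N)), functionalC (S F θ k) g φ X = 0)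
    (hnum : ∀ (F : T4Family) (θ : Stage12Params F N), θ.Provisos₁₂ F N → Rg F θ → θ.Admissible F N →
      0 < (li F θ).C₀ ∧ 0 < (li F θ).θ₅ ∧ (li F θ).θ₅ < 1 ∧ 0 ≤ (li F θ).C₅ ∧ 2 * (li F θ).C₅ / (1 - (li F θ).θ₅) ≤ (li F θ).C₀ ∧ 0 < (li F θ).A ∧
        (li F θ).θ₅ ≤ (li F θ).μ ∧ (li F θ).C₀ ≤ 2 * (li F θ).A ∧ 0 < (li F θ).r ∧ 0 < (li F θ).s ∧ (li F θ).s < 1 ∧ 1 ≤ (li F θ).μ)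
    (hstrip : ∀ (F : T4Family) (θ : Stage12Params F N), θ.Provisos₁₂ F N → Rg F θ → θ.Admissible F N → ∀ (k : ℕ),
      ∀ (j : ℕ) (g : ℕ → ℝ), g ∈ Window θ.γ → ∀ (i : ℕ) (Y : (domSys (F.P k) θ.τ9.M j).Dom) (ψ : CPair (F.P k) (MatA N)), ψ ∈ sp F θ k j Y →
        ∃ (Ec : ℂ → ℂ) (O : Set ℂ), IsOpen O ∧ (∀ t ∈ Ioc (0 : ℝ) θ.γ, closedBall (t : ℂ) (li F θ).r ⊆ O) ∧ DifferentiableOn ℂ Ec O ∧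
          (∀ z ∈ O, ‖Ec z‖ ≤ (li F θ).A * Real.exp (-((li F θ).κ * torusTreeLen Y.1))) ∧
          (∀ t ∈ Ioc (0 : ℝ) θ.γ, Ec t = termC (S F θ k) j Y (Function.update g i t) ψ))
    (hD4 : ∀ (F : T4Family) (θ : Stage12Params F N) (hP : θ.Provisos₁₂ F N), Rg F θ → θ.Admissible F N → ∀ k : ℕ,
      ReadOutAt (datumOfRecord₁₂ F N θ hP) (u3OfRecord₁₂ θ
        ((ReadingData.ofRecordAdm F θ.τ9.M N (S F θ) (sp F θ) (gauge F θ) (hg F θ) (T₀ F θ) (hT F θ) (li F θ)).u3Objects θ.γ) k))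
    (h20 : S_N20 (SRec₁₂On cr Rg)) (h21 : S_N21 (SRec₁₂On cr Rg))
    (hx : ∀ (F : T4Family) (θ : Stage12Params F N) (hP : θ.Provisos₁₂ F N), Rg F θ → θ.Admissible F N →
      B16.EndStatementBPrinted (datumOfRecord₁₂ F N θ hP).C → DagBinding.EndpointExistence (datumOfRecord₁₂ F N θ hP).C.toB12 →
        ForSmallCouplings (datumOfRecord₁₂ F N θ hP) fun g₀ => ∀ os : List (ULoop F),
          0 < (cr F θ hP g₀ os).l₀ ∧ 0 < (cr F θ hP g₀ os).vol ∧
          (∀ (K : ℕ) (t : ℝ), |t| ≤ (cr F θ hP g₀ os).l₀ →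
            T4GenFunBounds.schemeZ ((datumOfRecord₁₂ F N θ hP).scheme g₀) os ((cr F θ hP g₀ os).K₀ + K) t =
              ∑ τ ∈ (cr F θ hP g₀ os).T K, (cr F θ hP g₀ os).A K t τ) ∧
          (∀ (K : ℕ) (t : ℝ), |t| ≤ (cr F θ hP g₀ os).l₀ →
            T4GenFunBounds.schemeZ ((datumOfRecord₁₂ F N θ hP).scheme g₀) os ((cr F θ hP g₀ os).K₀ + K + 1) t =
              ∑ τ ∈ (cr F θ hP g₀ os).T K, (cr F θ hP g₀ os).B K t τ))
    (h19 : ∀ (F : T4Family) (θ : Stage12Params F N) (hP : θ.Provisos₁₂ F N), Rg F θ → θ.Admissible F N → ∀ (g₀ : ℕ → ℝ) (os : List (ULoop F)),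
      (∀ k : ℕ, RatesAt (datumOfRecord₁₂ F N θ hP) (rateCarriersOfRecord₁₂ (readingOfRecord₁₂
        (fun F θ => ReadingData.ofRecordAdm F θ.τ9.M N (S F θ) (sp F θ) (gauge F θ) (hg F θ) (T₀ F θ) (hT F θ) (li F θ)) ℓ₃ ne2 ne1) F θ hP g₀ os k)) →
        letI := (cr F θ hP g₀ os).dec
        ∃ δ : ℕ → ℝ, NE7.Core (cr F θ hP g₀ os).l₀ (cr F θ hP g₀ os).vol (cr F θ hP g₀ os).T (cr F θ hP g₀ os).Bad
          (fun K t τ => (cr F θ hP g₀ os).A K t τ - (cr F θ hP g₀ os).shA K t τ) (fun K t τ => (cr F θ hP g₀ os).B K t τ - (cr F θ hP g₀ os).shB K t τ) δ ∧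
          Summable δ) :
    Spine (N := N) fun F D w => Node00.IsRecordOfRecord₁₂COn F N Rg D w :=
  have h18' : S_N18 (RRec₁₂On (readingOfRecord₁₂
      (fun F θ => ReadingData.ofRecordAdm F θ.τ9.M N (S F θ) (sp F θ) (gauge F θ) (hg F θ) (T₀ F θ) (hT F θ) (li F θ)) ℓ₃ ne2 ne1) Rg) :=
    (s_N18_rRec₁₂On_iff _ Rg).mpr fun F θ hP hRg hθ _ _ k => (n18At_readingAdm_iff S sp gauge hg T₀ hT li F θ k).mpr (h18 F θ hP hRg hθ k)
  spine_rec12COn_at_readingOfRecord₁₂ cr _ ℓ₃ ne2 ne1 Rg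
    ((s_N14_rRec₁₂On_iff _ Rg).mpr fun F θ hP hRg hθ g₀ os => h14 F θ hP hRg hθ g₀ os)
    ((s_N15_rRec₁₂On_iff _ Rg).mpr fun F θ hP hRg hθ g₀ os k => h15 F θ hP hRg hθ g₀ os k)
    (s_N16_rRec₁₂On_readingOfRecord₁₂_of_leafSlot Rg _ ℓ₃ ne2 ne1 h16)
    h18' (s_N22_readingOfRecord₁₂On_ofRecordAdm_of_s_N18_stripBound S sp gauge hg T₀ hT li ℓ₃ ne2 ne1 Rg h18' hjunk hnum hstrip)
    ((s_D4_rRec₁₂On_iff _ Rg).mpr fun F θ hP hRg hθ _ _ k => hD4 F θ hP hRg hθ k) h20 h21 hx h19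

end Regime

end Summit.QuantumFields.YangMills.Theorems.BalabanUVNodesN27SpineRecord

end
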